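import Mathlib
import HarnessLib
import Literature.Analysis.FluidPDE.SverakLandauPoincare
import Literature.Analysis.FluidPDE.DipolePotentialFlow
import Summits.NavierStokesRegularity.NavierStokesRegularity.Theorems.UnthreadedDoorPotentialEvolutionCore
import Summits.NavierStokesRegularity.NavierStokesRegularity.Theorems.UnthreadedDoorCapSymDefs

/-!
# Route `UnthreadedDoor`, crux `PoloidalLiouville` (stmt-NavierStokesRegularity-1222), WALL W1 `stub_scalarLiouville` —
# crux idea «capsym-comparison» (ns-idea-13 g0), line input FL-A: THE VORTICAL HEAD POTENTIAL EXISTS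

KEY-NS #150 (2) / DIRECTOR-NS #246 (4).  Proves `CapSym.HeadPotentialExists` (typed in `…UnthreadedDoorCapSymDefs`, body
verbatim from the crux sketch `Cruxes/PoloidalLiouville/CapsymComparisonSketch.lean` 6f362c10523f): if `L, m ∈ C¹` and
`T ∈ C²` off `x₀` satisfy `∇L × (x − x₀) = ∇m × ∇T` there (hypothesis (E1) of `StubScalarLiouville` with `L = 𝓛T`,
`m = ⟪v, x − x₀⟫`), then `L·(x − x₀) = m ∇T − ∇Π` off `x₀` for a `C¹` head `Π`.

PROOF.  The head `1`-form `ω(x) = m(x)·DT(x) − L(x)·⟪x − x₀, ·⟫` is differentiable off `x₀` with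
`Dω(x)(h)(k) = m D²T(x)(h,k) + ⟪∇m,h⟫⟪∇T,k⟫ − L⟪h,k⟫ − ⟪∇L,h⟫⟪x − x₀,k⟫`; by Schwarz (`T ∈ C²`) and Lagrange's identity
`⟪a,h⟫⟪b,k⟫ − ⟪a,k⟫⟪b,h⟫ = ⟪a × b, h × k⟫` its antisymmetric part is `⟪∇m × ∇T − ∇L × (x − x₀), h × k⟫ = 0` by (E1), i.e.
`ω` is closed.  The tree's Poincaré lemma on `ℝ³ ∖ {0}` (`Sverak2011.exists_primitive_compl_zero`: four convex half-spaces,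
glued; Mathlib's convex Poincaré lemma) applied to `y ↦ ω(y + x₀)` gives a primitive; translating back, `DΠ = ω`, so
`∇Π = m∇T − L·(x − x₀)` (Riesz) and `Π ∈ C¹` (`DΠ = ω` is continuous on the open set `{x ≠ x₀}`).

* `CapSym.inner_cross_cross` — Lagrange's identity on `ℝ³`;
* `CapSym.headPotentialExists : CapSym.HeadPotentialExists` — FL-A.

WHAT THIS IS NOT: no NS-regularity statement is touched; this is frozen-time vector calculus (an INPUT of one crux idea card);
`PoloidalLiouville` (1222), its wall `stub_scalarLiouville` and the summit stay OPEN.  `--supports stmt-NavierStokesRegularity-1222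
--as helper`.  [cite: Sverak2011, §4 ("since `dv = 0` we can write `v = ∇φ`")]
-/

noncomputable section

-- the summit and its single sub-problem share the name (CONVENTIONS §1)
set_option linter.dupNamespace false

open Set Function Filter Topology InnerProductSpace
open scoped RealInnerProductSpace

namespace Summit.NavierStokesRegularity.NavierStokesRegularity.Theorems.PoloidalLiouville.CapSym

open Literature.Analysis Literature.Analysis.FluidPDE
/-! ### Lagrange's identity -/

/-- **Lagrange's identity** on `ℝ³`: `⟪a × b, c × d⟫ = ⟪a, c⟫⟪b, d⟫ − ⟪a, d⟫⟪b, c⟫`. [folklore] -/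
theorem inner_cross_cross (a b c d : EuclideanSpace ℝ (Fin 3)) :
    ⟪cross a b, cross c d⟫ = ⟪a, c⟫ * ⟪b, d⟫ - ⟪a, d⟫ * ⟪b, c⟫ := by
  simp only [Tao2016.real_inner_fin3, cross_apply_zero, cross_apply_one, cross_apply_two]
  ring

/-! ### FL-A -/

set_option maxHeartbeats 400000 in
/-- **FL-A: the vortical head potential exists** (`CapSym.HeadPotentialExists`): for `L, m ∈ C¹({x₀}ᶜ)`, `T ∈ C²({x₀}ᶜ)` with
`∇L × (x − x₀) = ∇m × ∇T` off `x₀`, there is `Π ∈ C¹({x₀}ᶜ)` with `L·(x − x₀) = m ∇T − ∇Π` off `x₀` — the head `1`-form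
`m·DT − L·⟪x − x₀, ·⟫` is closed (Schwarz + Lagrange + (E1)) on the simply connected `ℝ³ ∖ {x₀}`, hence exact
(`Sverak2011.exists_primitive_compl_zero`). [cite: Sverak2011, §4] -/
theorem headPotentialExists : HeadPotentialExists := by
  intro x₀ L m T hL hm hT hE
  have hO : IsOpen (({x₀}ᶜ : Set (EuclideanSpace ℝ (Fin 3)))) := isOpen_compl_singleton
  have hLa : ∀ x : EuclideanSpace ℝ (Fin 3), x ≠ x₀ → ContDiffAt ℝ 1 L x := fun x hx =>
    hL.contDiffAt (hO.mem_nhds hx)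
  have hma : ∀ x : EuclideanSpace ℝ (Fin 3), x ≠ x₀ → ContDiffAt ℝ 1 m x := fun x hx =>
    hm.contDiffAt (hO.mem_nhds hx)
  have hTa : ∀ x : EuclideanSpace ℝ (Fin 3), x ≠ x₀ → ContDiffAt ℝ 2 T x := fun x hx =>
    hT.contDiffAt (hO.mem_nhds hx)
  have hLd : ∀ x : EuclideanSpace ℝ (Fin 3), x ≠ x₀ → HasFDerivAt L (fderiv ℝ L x) x := fun x hx =>
    ((hLa x hx).differentiableAt (by norm_num)).hasFDerivAt
  have hmd : ∀ x : EuclideanSpace ℝ (Fin 3), x ≠ x₀ → HasFDerivAt m (fderiv ℝ m x) x := fun x hx =>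
    ((hma x hx).differentiableAt (by norm_num)).hasFDerivAt
  have hTd : ∀ x : EuclideanSpace ℝ (Fin 3), x ≠ x₀ →
      HasFDerivAt (fderiv ℝ T) (fderiv ℝ (fderiv ℝ T) x) x := fun x hx =>
    (((hTa x hx).fderiv_right (m := 1) (by norm_cast)).differentiableAt (by norm_num)).hasFDerivAt
  -- the head 1-form
  set ω : EuclideanSpace ℝ (Fin 3) → EuclideanSpace ℝ (Fin 3) →L[ℝ] ℝ :=
    fun x => m x • fderiv ℝ T x - L x • innerSL ℝ (x - x₀) with hω
  have hιD : ∀ x : EuclideanSpace ℝ (Fin 3), HasFDerivAt (fun y : EuclideanSpace ℝ (Fin 3) => innerSL ℝ (y - x₀))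
      (innerSL ℝ : EuclideanSpace ℝ (Fin 3) →L[ℝ] EuclideanSpace ℝ (Fin 3) →L[ℝ] ℝ) x := by
    intro x
    have h := ((innerSL ℝ : EuclideanSpace ℝ (Fin 3) →L[ℝ] EuclideanSpace ℝ (Fin 3) →L[ℝ] ℝ).hasFDerivAt).comp x
      (hasFDerivAt_sub_const x₀)
    rw [ContinuousLinearMap.comp_id] at h
    exact h
  have hωD : ∀ x : EuclideanSpace ℝ (Fin 3), x ≠ x₀ → HasFDerivAt ω
      (m x • fderiv ℝ (fderiv ℝ T) x + (fderiv ℝ m x).smulRight (fderiv ℝ T x) -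
        (L x • (innerSL ℝ : EuclideanSpace ℝ (Fin 3) →L[ℝ] EuclideanSpace ℝ (Fin 3) →L[ℝ] ℝ) +
          (fderiv ℝ L x).smulRight (innerSL ℝ (x - x₀)))) x := by
    intro x hx
    exact ((hmd x hx).smul (hTd x hx)).sub ((hLd x hx).smul (hιD x))
  -- `ω` is closed: symmetry of `Dω`
  have hsymm : ∀ x : EuclideanSpace ℝ (Fin 3), x ≠ x₀ → ∀ h k : EuclideanSpace ℝ (Fin 3),
      fderiv ℝ ω x h k = fderiv ℝ ω x k h := by
    intro x hx h k
    rw [(hωD x hx).fderiv]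
    have hS : fderiv ℝ (fderiv ℝ T) x h k = fderiv ℝ (fderiv ℝ T) x k h :=
      ((hTa x hx).isSymmSndFDerivAt (by simp)).eq h k
    have h1 : fderiv ℝ m x h = ⟪gradient m x, h⟫ := (LocalHelmholtz.inner_gradient_left_eq_fderiv m x h).symm
    have h2 : fderiv ℝ m x k = ⟪gradient m x, k⟫ := (LocalHelmholtz.inner_gradient_left_eq_fderiv m x k).symm
    have h3 : fderiv ℝ T x h = ⟪gradient T x, h⟫ := (LocalHelmholtz.inner_gradient_left_eq_fderiv T x h).symm
    have h4 : fderiv ℝ T x k = ⟪gradient T x, k⟫ := (LocalHelmholtz.inner_gradient_left_eq_fderiv T x k).symm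
    have h5 : fderiv ℝ L x h = ⟪gradient L x, h⟫ := (LocalHelmholtz.inner_gradient_left_eq_fderiv L x h).symm
    have h6 : fderiv ℝ L x k = ⟪gradient L x, k⟫ := (LocalHelmholtz.inner_gradient_left_eq_fderiv L x k).symm
    have hlag₁ := inner_cross_cross (gradient m x) (gradient T x) h k
    have hlag₂ := inner_cross_cross (gradient L x) (x - x₀) h k
    rw [hE x hx] at hlag₂
    have hhk : ⟪h, k⟫ = ⟪k, h⟫ := real_inner_comm _ _
    have ev : ∀ a b : EuclideanSpace ℝ (Fin 3),
        (m x • fderiv ℝ (fderiv ℝ T) x + (fderiv ℝ m x).smulRight (fderiv ℝ T x) -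
          (L x • (innerSL ℝ : EuclideanSpace ℝ (Fin 3) →L[ℝ] EuclideanSpace ℝ (Fin 3) →L[ℝ] ℝ) +
            (fderiv ℝ L x).smulRight (innerSL ℝ (x - x₀)))) a b
          = m x * fderiv ℝ (fderiv ℝ T) x a b + fderiv ℝ m x a * fderiv ℝ T x b -
            (L x * ⟪a, b⟫ + fderiv ℝ L x a * ⟪x - x₀, b⟫) := by
      intro a b
      have hι : ((innerSL ℝ : EuclideanSpace ℝ (Fin 3) →L[ℝ] EuclideanSpace ℝ (Fin 3) →L[ℝ] ℝ) a) b = ⟪a, b⟫ := rfl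
      simp only [_root_.sub_apply, _root_.add_apply, _root_.smul_apply,
        ContinuousLinearMap.smulRight_apply, innerSL_apply_apply, smul_eq_mul, hι]
    rw [ev, ev, hS, h1, h2, h3, h4, h5, h6]
    linear_combination hlag₂ - hlag₁ - L x * hhk
  -- translate `x₀` to the origin and apply the Poincaré lemma on `ℝ³ ∖ {0}`
  set ω₀ : EuclideanSpace ℝ (Fin 3) → EuclideanSpace ℝ (Fin 3) →L[ℝ] ℝ := fun y => ω (y + x₀) with hω₀
  have hτ : ∀ y : EuclideanSpace ℝ (Fin 3), HasFDerivAt (fun z : EuclideanSpace ℝ (Fin 3) => z + x₀)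
      (ContinuousLinearMap.id ℝ (EuclideanSpace ℝ (Fin 3))) y := fun y => by
    simpa using (hasFDerivAt_id y).add_const x₀
  have hy0 : ∀ y : EuclideanSpace ℝ (Fin 3), y ≠ 0 → y + x₀ ≠ x₀ := fun y hy h => hy (by simpa using h)
  have hω₀D : ∀ y : EuclideanSpace ℝ (Fin 3), y ≠ 0 → HasFDerivAt ω₀ (fderiv ℝ ω (y + x₀)) y := by
    intro y hy
    have h := ((hωD (y + x₀) (hy0 y hy)).comp y (hτ y))
    rw [ContinuousLinearMap.comp_id] at h
    rw [(hωD (y + x₀) (hy0 y hy)).fderiv]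
    exact h
  have hω₀d : DifferentiableOn ℝ ω₀ {y : EuclideanSpace ℝ (Fin 3) | y ≠ 0} := fun y hy =>
    (hω₀D y hy).differentiableAt.differentiableWithinAt
  obtain ⟨φ₀, hφ₀⟩ := Sverak2011.exists_primitive_compl_zero (F := ℝ) hω₀d (fun a ha h k => by
    rw [(hω₀D a ha).fderiv]
    exact hsymm (a + x₀) (hy0 a ha) h k)
  -- the head potential
  set P : EuclideanSpace ℝ (Fin 3) → ℝ := fun x => φ₀ (x - x₀) with hP
  have hPD : ∀ x : EuclideanSpace ℝ (Fin 3), x ≠ x₀ → HasFDerivAt P (ω x) x := by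
    intro x hx
    have hx' : x - x₀ ≠ 0 := sub_ne_zero.2 hx
    have h := (hφ₀ (x - x₀) hx').comp x (hasFDerivAt_sub_const x₀)
    rw [ContinuousLinearMap.comp_id] at h
    have e : ω₀ (x - x₀) = ω x := by simp only [hω₀, sub_add_cancel]
    rw [e] at h
    exact h
  refine ⟨P, ?_, fun x hx => ?_⟩
  · -- `P ∈ C¹({x₀}ᶜ)`: `DP = ω` is continuous there
    have hωc : ContinuousOn ω ({x₀}ᶜ) := by
      have hmc : ContinuousOn m ({x₀}ᶜ) := hm.continuousOn
      have hLc : ContinuousOn L ({x₀}ᶜ) := hL.continuousOn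
      have hTc : ContinuousOn (fderiv ℝ T) ({x₀}ᶜ) := hT.continuousOn_fderiv_of_isOpen hO (by norm_num)
      have hιc : Continuous (fun y : EuclideanSpace ℝ (Fin 3) => innerSL ℝ (y - x₀)) :=
        (innerSL ℝ : EuclideanSpace ℝ (Fin 3) →L[ℝ] EuclideanSpace ℝ (Fin 3) →L[ℝ] ℝ).continuous.comp
          (continuous_id.sub continuous_const)
      exact (hmc.smul hTc).sub (hLc.smul hιc.continuousOn)
    have hfd : ∀ x ∈ ({x₀}ᶜ : Set (EuclideanSpace ℝ (Fin 3))), fderiv ℝ P x = ω x := fun x hx =>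
      (hPD x hx).fderiv
    rw [show (1 : WithTop ℕ∞) = 0 + 1 from (zero_add 1).symm, contDiffOn_succ_iff_fderiv_of_isOpen hO]
    refine ⟨fun x hx => (hPD x hx).differentiableAt.differentiableWithinAt, by simp, ?_⟩
    exact (contDiffOn_zero.2 hωc).congr hfd
  · -- `∇P = m ∇T − L (x − x₀)`
    have hg : gradient P x = m x • gradient T x - L x • (x - x₀) := by
      rw [gradient, (hPD x hx).fderiv,
        show ω x = m x • fderiv ℝ T x - L x • innerSL ℝ (x - x₀) from rfl,
        map_sub, map_smulₛₗ, map_smulₛₗ, toDual_symm_innerSL]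
      simp only [conj_trivial]
      rfl
    rw [hg, sub_sub_cancel]

end Summit.NavierStokesRegularity.NavierStokesRegularity.Theorems.PoloidalLiouville.CapSym

end
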